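import Literature.MathematicalPhysics.QuantumFieldTheory.Balaban1983to89.B11Eq115Space
import HarnessLib

/-!
# Route `UnitScaleTilt`, crux K1 child «MinimiserStabilityRegPr» (stmt-QuantumFields-19200), leaf V2′ `stub_halvingStep` — PILLAR F4, PART 6:
# **[Balaban1985Variational] PROP. 6 FOR EQ. (158) WITH THE MULTI-LEVEL WEIGHTS OF SECT. F** — the space (115)
# `max{ sup_j (L^jη)·sup_{Ω′_j}|A₁|, sup_j (L^jη)²·sup_{Ω′_j}|∇^ηA₁| }` and the current size `|·|₍₋₃₎ = sup_j (L^jη)³ sup_{Ω′_j}|·|` on the CUBE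
# SEQUENCE (144) `□₀ ⊃ □₁ ⊃ … ⊃ □_k` ((152): *«L^jη|A|, (L^jη)²|∇A|, … < 9dL²B₁Mε₀ on Ω′_j, j = 0, 1, …, k»*; (156)–(157): *«L^jηQ_jA′ = B on Λ′_j,
# j = 0, 1, …, k»*), typed ONCE over ARBITRARY finite index types `ι` (the bonds of `□̃`), `κ` (the pairs `(b, b + e_ν)` inside it, given by
# `src tgt : κ → ι`) and POSITIVE WEIGHTS `w₀, w₁` (for `A`, `∇A`) and `w₃` (for currents) — so that both the one-level carrier of parts 1–3
# (`ι = PBond (F.P K) 0`, `w₀ = w₃ = 1`, `w₁ = L^{K−n}`) and the localised multi-level geometry of Sect. F (`w_n(b) = (L^{j(b)}η)^n·`const) are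
# instances by `rfl`

Cell `ym3-torus` (HUMAN RULING D-0037, YM ladder rung R3), seat `ym-ust-19200-f4` gen 0.  `--supports stmt-QuantumFields-19200 --as helper`;
count-neutral; sixth file of pillar F4.  WHY (ym3-torus-p1 g15 located note, 2026-08-27; lit L-21 caveat (i)): print's Sect. F runs the chart (47),
the equation (158) and the contraction on the cube sequence (144) with constraints at EVERY level (`Λ′_j`) and LEVEL-DEPENDENT weights `(L^jη)^n`
— the localisation radius `M` is load-bearing in (165)–(166) — whereas parts 1–3 fixed one level; this file removes that restriction without
changing a line of the analysis (lit-balaban's `B11Eq115Space.JetSup w₀ w₁ ∇` / `NegSup w₃` are weighted by design).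

THE PRINT ([Balaban1985Variational], CMP **102** (1985)).  p. 286: *«sup_j L^jη sup_{Ω_j}|A′| = |A′|₍₋₁₎»*; p. 294 (115): *«|A₁| < ε₄(L^jη)⁻¹, |∇A₁| <
ε₄(L^jη)⁻² on Ω_j, i.e. max{|A₁|₍₋₁₎, |∇A₁|₍₋₂₎} < ε₄»*; p. 295 Prop. 6; p. 302 (158) *«A₁ + G̃((δ/δA′)V)(A₁ + HB) = 0 … The configurations HB and
A₁ satisfy (152) with the bounds 4dL²B₁Mε₀ and 40dL²B₁Mε₀ correspondingly … we assume that 40dL²B₁Mε₀ ≤ a₄»*; p. 304 (165).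

WHAT IS PROVED (sorry-free; no definition; axioms standard), for finite `ι κ`, maps `src tgt : κ → ι`, weights `w₀ w₃ : ι → ℝ`, `w₁ : κ → ℝ` (all `> 0`),
fibre `V` = any finite-dimensional complex normed space (𝔤ᶜ); «(115)-size of `A` ≤ r» means `w₀ i·‖A i‖ ≤ r ∀ i` and `w₁ p·‖A(tgt p) − A(src p)‖ ≤ r ∀ p`,
«current size of `f` ≤ β» means `w₃ i·‖f i‖ ≤ β ∀ i`:
* §1 `exists_diffLin` — `A ↦ (p ↦ A(tgt p) − A(src p))` as a ℂ-linear map.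
* §2 **`existsUnique_smallSolution158W`** — Prop. 6 for (158): `G` ℂ-linear with «current size `f` ≤ β ⇒ (115)-size `Gf` ≤ B₀β»; `W` with (98) «(115)-size
  `Y` ≤ r < a₃ ⇒ current size `W Y` ≤ C₄r²» and `DifferentiableOn ℂ W` on the open (115)-ball of radius `a₃`; `𝔄` of (115)-size `< a ≤ ε₄`, `0 < a`;
  `4ε₄ ≤ a₃`, `16B₀C₄ε₄ ≤ 1` ⟹ EXACTLY ONE `A₁` of (115)-size `≤ ε₄` with `A₁ + G(W(A₁ + 𝔄)) = 0`; **`smallSolution158W_valued`** — every such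
  solution is `S`-valued for a closed invariant value set `S ∋ 0` (reality: `S = su(2)`).
* §3 **`letter_solution158W_le`** — the (165) entry for an arbitrary real letter `N`: `N(−Gf) ≤ B_N·β` under «current size `f` ≤ β» and (98) give
  `N(A₁) ≤ B_N·C₄ρ²` for EVERY solution with (115)-size(`A₁ + 𝔄`) `≤ ρ < a₃`; `solution158W_mem_ker` (`Q ∘ G = 0 ⇒ QA₁ = 0`).
Mechanism: `B11Eq115Space.JetSup w₀ w₁ ∇` / `NegSup w₃` + `B11Prop6Scheme.eq158_solution` / `solution_mem_of_invariant` BY NAME, read back pointwise.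
HONEST SCOPE as parts 1–3: `G̃`, `W`, `𝔄` and their constants are hypotheses (pillars F3 / C_k / F1–F5 / Prop. 4); the file chooses no geometry —
the cube sequence, its level map `j(·)` and weights are the user's instance; NOT a claim about the mass gap.

References: T. Bałaban, CMP **102** (1985) 277–309 [Balaban1985Variational] p.286, (115) p.294, Prop. 6 p.295, (144)/(152)/(156)–(158) pp.300–302, (165) p.304.
-/

set_option autoImplicit false

noncomputable section

open Metric Set

namespace Summit.QuantumFields.YangMills.Theorems.FlatSmallSolution158Levels

open Literature.MathematicalPhysics.QuantumFieldTheory.Balaban1983to89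
open Literature.MathematicalPhysics.QuantumFieldTheory.Balaban1983to89.B11Eq115Space
open Literature.MathematicalPhysics.QuantumFieldTheory.Balaban1983to89.B11Prop6Scheme (mapT mapT_158 eq158_solution solution_mem_of_invariant)
open Literature.MathematicalPhysics.QuantumFieldTheory.Balaban1983to89.B13Contraction113 (QuadAnalytic)

variable {ι κ : Type*} [Fintype ι] [Fintype κ] {V : Type*} [NormedAddCommGroup V] [NormedSpace ℂ V]

/-! ## §1 The difference map of a pair structure -/

omit [Fintype ι] [Fintype κ] [NormedAddCommGroup V] [NormedSpace ℂ V] in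
/-- The difference `A ↦ (p ↦ A(tgt p) − A(src p))` along a pair structure `src tgt : κ → ι` (print: `p = (b, ν)`, `src p = b`, `tgt p = b + e_ν`,
inside the cube `□̃`) IS ℂ-linear — as an existence statement (no definition). [cite: Balaban1985Variational, (115) p.294] -/
theorem exists_diffLin (src tgt : κ → ι) (W' : Type*) [AddCommGroup W'] [Module ℂ W'] :
    ∃ D : (ι → W') →ₗ[ℂ] (κ → W'), ∀ (A : ι → W') (p : κ), D A p = A (tgt p) - A (src p) :=
  ⟨{ toFun := fun A p => A (tgt p) - A (src p)
     map_add' := fun A B => by funext p; simp only [Pi.add_apply]; abel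
     map_smul' := fun z A => by funext p; simp only [Pi.smul_apply, RingHom.id_apply, smul_sub] },
    fun _ _ => rfl⟩

/-! ## §2 Proposition 6 for (158) with arbitrary positive weights (the multi-level sizes of Sect. F) -/

/-- **[Balaban1985Variational] PROPOSITION 6 FOR EQ. (158) IN THE WEIGHTED SIZES (115)/p. 286** on arbitrary finite index types with a pair
structure `src, tgt` and positive weights `w₀` (for `|A|₍₋₁₎`), `w₁` (for `|∇A|₍₋₂₎`), `w₃` (for `|·|₍₋₃₎`) — print: `w_n = (L^{j(·)}η)^n` on the cube sequence
(144).  Data: `G` (print `G̃`) ℂ-linear with «`w₃·|f| ≤ β` ⇒ (115)-size of `Gf` `≤ B₀β`»; `W = (δ/δA′)V` with (98) pointwise and holomorphic on the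
(115)-ball of radius `a₃`; `𝔄 = HB` of (115)-size `< a`, `0 < a ≤ ε₄`; `4ε₄ ≤ a₃`, `16B₀C₄ε₄ ≤ 1`.  Conclusion: EXACTLY ONE `A₁` of (115)-size `≤ ε₄` with
`A₁ + G(W(A₁ + 𝔄)) = 0`, AND: for every closed `S ⊆ V` with `0 ∈ S` such that `X ↦ −G(W(X + 𝔄))` maps `S`-valued fields of size `≤ ε₄` to `S`-valued
fields, that solution (indeed every solution of size `≤ ε₄`) is `S`-valued.  Proof: `B11Prop6Scheme.eq158_solution` and `solution_mem_of_invariant` at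
`𝒴 := JetSup w₀ w₁ ∇`, `𝒵 := NegSup w₃`. [cite: Balaban1985Variational, Prop. 6 p.295, (158) p.302, (152) p.301] -/
theorem existsUnique_smallSolution158W_valued [FiniteDimensional ℂ V] (src tgt : κ → ι)
    {w₀ w₃ : ι → ℝ} {w₁ : κ → ℝ} (hw₀ : ∀ i, 0 < w₀ i) (hw₁ : ∀ p, 0 < w₁ p) (hw₃ : ∀ i, 0 < w₃ i)
    (G : (ι → V) →ₗ[ℂ] (ι → V)) (W : (ι → V) → (ι → V)) {B₀ C₄ a₃ a ε₄ : ℝ} (hB₀ : 0 ≤ B₀) (hC₄ : 0 ≤ C₄)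
    (hG : ∀ (f : ι → V) (β : ℝ), (∀ i, w₃ i * ‖f i‖ ≤ β) →
      (∀ i, w₀ i * ‖G f i‖ ≤ B₀ * β) ∧ ∀ p, w₁ p * ‖G f (tgt p) - G f (src p)‖ ≤ B₀ * β)
    (hWq : ∀ (Y : ι → V) (r : ℝ), r < a₃ → (∀ i, w₀ i * ‖Y i‖ ≤ r) → (∀ p, w₁ p * ‖Y (tgt p) - Y (src p)‖ ≤ r) →
      ∀ i, w₃ i * ‖W Y i‖ ≤ C₄ * r ^ 2)
    (hWd : DifferentiableOn ℂ W {Y : ι → V | (∀ i, w₀ i * ‖Y i‖ < a₃) ∧ ∀ p, w₁ p * ‖Y (tgt p) - Y (src p)‖ < a₃})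
    (𝔄 : ι → V) (ha0 : 0 < a) (h𝔄 : ∀ i, w₀ i * ‖𝔄 i‖ < a) (h𝔄' : ∀ p, w₁ p * ‖𝔄 (tgt p) - 𝔄 (src p)‖ < a)
    (ha : a ≤ ε₄) (hε₄ : 0 ≤ ε₄) (h2 : 4 * ε₄ ≤ a₃) (h3 : 16 * B₀ * C₄ * ε₄ ≤ 1) :
    (∃! A₁ : ι → V, ((∀ i, w₀ i * ‖A₁ i‖ ≤ ε₄) ∧ ∀ p, w₁ p * ‖A₁ (tgt p) - A₁ (src p)‖ ≤ ε₄) ∧ A₁ + G (W (A₁ + 𝔄)) = 0) ∧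
    ∀ (S : Set V), IsClosed S → (0 : V) ∈ S →
      (∀ X : ι → V, (∀ i, X i ∈ S) → (∀ i, w₀ i * ‖X i‖ ≤ ε₄) → (∀ p, w₁ p * ‖X (tgt p) - X (src p)‖ ≤ ε₄) →
        ∀ i, -(G (W (X + 𝔄)) i) ∈ S) →
      ∀ A₁ : ι → V, ((∀ i, w₀ i * ‖A₁ i‖ ≤ ε₄) ∧ ∀ p, w₁ p * ‖A₁ (tgt p) - A₁ (src p)‖ ≤ ε₄) →
        A₁ + G (W (A₁ + 𝔄)) = 0 → ∀ i, A₁ i ∈ S := by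
  classical
  obtain ⟨D, hD⟩ := exists_diffLin src tgt V
  haveI : Fact (∀ i, 0 < w₀ i) := ⟨hw₀⟩
  haveI : Fact (∀ p, 0 < w₁ p) := ⟨hw₁⟩
  haveI : Fact (∀ i, 0 < w₃ i) := ⟨hw₃⟩
  let eY := JetSup.equiv (𝕜 := ℂ) (V := V) w₀ w₁ D
  let eZ := NegSup.equiv w₃ V
  -- pointwise reading of the norms
  have hYle : ∀ (X : JetSup w₀ w₁ D) (r : ℝ), 0 ≤ r →
      (‖X‖ ≤ r ↔ (∀ i, w₀ i * ‖eY X i‖ ≤ r) ∧ ∀ p, w₁ p * ‖eY X (tgt p) - eY X (src p)‖ ≤ r) := by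
    intro X r hr
    rw [JetSup.norm_le_iff_pointwise hr]
    exact and_congr Iff.rfl (forall_congr' fun p => by rw [hD])
  have hYlt : ∀ (X : JetSup w₀ w₁ D) (r : ℝ), 0 < r →
      (‖X‖ < r ↔ (∀ i, w₀ i * ‖eY X i‖ < r) ∧ ∀ p, w₁ p * ‖eY X (tgt p) - eY X (src p)‖ < r) := by
    intro X r hr
    rw [JetSup.norm_lt_iff_pointwise hr]
    exact and_congr Iff.rfl (forall_congr' fun p => by rw [hD])
  have hZle : ∀ (f : NegSup w₃ V) (r : ℝ), 0 ≤ r → (‖f‖ ≤ r ↔ ∀ i, w₃ i * ‖eZ f i‖ ≤ r) := fun f r hr =>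
    NegSup.norm_le_iff hr
  have hZpt : ∀ (f : NegSup w₃ V) (i : ι), w₃ i * ‖eZ f i‖ ≤ ‖f‖ := fun f i =>
    ((hZle f ‖f‖ (norm_nonneg _)).1 le_rfl) i
  -- the operator 𝒢 and the map 𝒲
  let 𝒢ₗ : NegSup w₃ V →ₗ[ℂ] JetSup w₀ w₁ D :=
    { toFun := fun f => eY.symm (G (eZ f))
      map_add' := fun f g => by
        apply eY.injective; simp only [Equiv.apply_symm_apply, eY, eZ, NegSup.equiv_add, map_add, JetSup.equiv_add]
      map_smul' := fun z f => by
        apply eY.injective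
        simp only [Equiv.apply_symm_apply, eY, eZ, NegSup.equiv_smul, map_smul, JetSup.equiv_smul, RingHom.id_apply] }
  let 𝒢 : NegSup w₃ V →L[ℂ] JetSup w₀ w₁ D := LinearMap.toContinuousLinearMap 𝒢ₗ
  have h𝒢apply : ∀ f, eY (𝒢 f) = G (eZ f) := fun f => rfl
  have h𝒢 : ∀ f, ‖𝒢 f‖ ≤ B₀ * ‖f‖ := by
    intro f
    have hb := hG (eZ f) ‖f‖ (hZpt f)
    rw [hYle _ _ (mul_nonneg hB₀ (norm_nonneg _)), h𝒢apply]
    exact hb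
  let 𝒲 : JetSup w₀ w₁ D → NegSup w₃ V := fun Y => eZ.symm (W (eY Y))
  have h𝒲apply : ∀ Y, eZ (𝒲 Y) = W (eY Y) := fun Y => rfl
  have h𝒲 : QuadAnalytic 𝒲 C₄ a₃ := by
    refine ⟨fun Y hY => ?_, fun Pt Q => ?_⟩
    · have hpt := (hYle Y ‖Y‖ (norm_nonneg _)).1 le_rfl
      have hb := hWq (eY Y) ‖Y‖ hY hpt.1 hpt.2
      rw [hZle _ _ (mul_nonneg hC₄ (sq_nonneg _)), h𝒲apply]
      exact hb
    · have ha₃ : ∀ ζ : ℂ, ‖Pt + ζ • Q‖ < a₃ → 0 < a₃ := fun ζ h => (norm_nonneg _).trans_lt h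
      have hline : Differentiable ℂ (fun ζ : ℂ => eY Pt + ζ • eY Q) :=
        (differentiable_const _).add (differentiable_id.smul_const _)
      have hinto : MapsTo (fun ζ : ℂ => eY Pt + ζ • eY Q) {ζ : ℂ | ‖Pt + ζ • Q‖ < a₃}
          {Y : ι → V | (∀ i, w₀ i * ‖Y i‖ < a₃) ∧ ∀ p, w₁ p * ‖Y (tgt p) - Y (src p)‖ < a₃} := by
        intro ζ hζ
        exact (hYlt (Pt + ζ • Q) a₃ (ha₃ ζ hζ)).1 hζ
      have hcomp : DifferentiableOn ℂ (fun ζ : ℂ => W (eY Pt + ζ • eY Q)) {ζ : ℂ | ‖Pt + ζ • Q‖ < a₃} :=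
        hWd.comp hline.differentiableOn hinto
      exact (NegSup.continuousLinearEquiv ℂ w₃ (V := V)).symm.differentiable.comp_differentiableOn hcomp
  have h𝔄Y : ‖eY.symm 𝔄‖ < a := by
    rw [hYlt _ _ ha0]
    exact ⟨h𝔄, h𝔄'⟩
  -- (158) read back on the index
  have hcomp : ∀ X : JetSup w₀ w₁ D, eY (-𝒢 (𝒲 (X + eY.symm 𝔄))) = -(G (W (eY X + 𝔄))) := fun X => rfl
  have hfix : ∀ X : JetSup w₀ w₁ D, (-𝒢 (𝒲 (X + eY.symm 𝔄)) = X ↔ eY X + G (W (eY X + 𝔄)) = 0) := by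
    intro X
    constructor
    · intro h
      have e1 : eY X = -(G (W (eY X + 𝔄))) := ((congrArg eY h).symm).trans (hcomp X)
      exact eq_neg_iff_add_eq_zero.1 e1
    · intro h
      apply eY.injective
      rw [hcomp X]
      exact (eq_neg_of_add_eq_zero_left h).symm
  refine ⟨?_, fun S hS h0 hinv A₁ hA₁ hsol => ?_⟩
  · -- existence and uniqueness
    obtain ⟨X, ⟨hXn, hXfix⟩, huniq⟩ := eq158_solution (𝒢 := 𝒢) (W := 𝒲) h𝒢 h𝒲 hB₀ hC₄ h𝔄Y ha hε₄ h2 h3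
    refine ⟨eY X, ⟨(hYle X ε₄ hε₄).1 hXn, (hfix X).1 hXfix⟩, fun A₁ hA₁ => ?_⟩
    have h1 : ‖eY.symm A₁‖ ≤ ε₄ := (hYle _ ε₄ hε₄).2 hA₁.1
    have h2' : -𝒢 (𝒲 (eY.symm A₁ + eY.symm 𝔄)) = eY.symm A₁ := (hfix _).2 hA₁.2
    have := huniq (eY.symm A₁) ⟨h1, h2'⟩
    rw [← this]
    rfl
  · -- values in the closed invariant set
    have hΛ : ∀ Y : JetSup w₀ w₁ D, ‖(0 : JetSup w₀ w₁ D →L[ℂ] JetSup w₀ w₁ D) Y‖ ≤ 0 * ‖Y‖ := fun Y => by simp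
    have hJ : ‖(0 : NegSup w₃ V)‖ ≤ 0 := by simp
    have hm : ε₄ + a ≤ 2 * ε₄ := by linarith
    have hm0 : 0 ≤ ε₄ + a := by linarith
    have hdom : 2 * (ε₄ + a) ≤ a₃ := by linarith
    have hself : B₀ * 0 + 0 * (ε₄ + a) + B₀ * C₄ * (ε₄ + a) ^ 2 ≤ ε₄ := by
      have e1 : (ε₄ + a) ^ 2 ≤ (2 * ε₄) ^ 2 := pow_le_pow_left₀ hm0 hm 2
      have e2 : B₀ * C₄ * (ε₄ + a) ^ 2 ≤ B₀ * C₄ * (2 * ε₄) ^ 2 := mul_le_mul_of_nonneg_left e1 (by positivity)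
      have e3 : 16 * B₀ * C₄ * ε₄ * ε₄ ≤ 1 * ε₄ := mul_le_mul_of_nonneg_right h3 hε₄
      nlinarith
    have hcontr : 0 + 4 * B₀ * C₄ * (ε₄ + a) < 1 := by
      have e1 : 4 * B₀ * C₄ * (ε₄ + a) ≤ 4 * B₀ * C₄ * (2 * ε₄) := mul_le_mul_of_nonneg_left hm (by positivity)
      nlinarith
    let S' : Set (JetSup w₀ w₁ D) := ⋂ i : ι, (JetSup.evalCLM w₀ w₁ D i) ⁻¹' S
    have hmemS' : ∀ X : JetSup w₀ w₁ D, X ∈ S' ↔ ∀ i, eY X i ∈ S := by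
      intro X
      simp only [S', Set.mem_iInter, Set.mem_preimage, JetSup.evalCLM_apply]
      exact Iff.rfl
    have hS'closed : IsClosed S' :=
      isClosed_iInter fun i => hS.preimage (JetSup.evalCLM w₀ w₁ D i).continuous
    have h0' : (0 : JetSup w₀ w₁ D) ∈ S' := (hmemS' 0).2 fun _ => h0
    have hinv' : ∀ X ∈ S', ‖X‖ ≤ ε₄ → mapT 𝒢 0 𝒲 0 (eY.symm 𝔄) X ∈ S' := by
      intro X hX hXn
      rw [mapT_158, hmemS', hcomp]
      have hpt := (hYle X ε₄ hε₄).1 hXn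
      exact hinv (eY X) ((hmemS' X).1 hX) hpt.1 hpt.2
    have hXn : ‖eY.symm A₁‖ ≤ ε₄ := (hYle _ ε₄ hε₄).2 hA₁
    have hfixA : mapT 𝒢 0 𝒲 0 (eY.symm 𝔄) (eY.symm A₁) = eY.symm A₁ := by
      rw [mapT_158]
      exact (hfix _).2 hsol
    have hmem : eY.symm A₁ ∈ S' :=
      solution_mem_of_invariant (J := (0 : NegSup w₃ V)) h𝒢 hΛ h𝒲 hB₀ hC₄ le_rfl hJ h𝔄Y hε₄ hdom hself hcontr S'
        hS'closed h0' hinv' hXn hfixA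
    exact (hmemS' _).1 hmem

/-- **PROP. 6 FOR (158), WEIGHTED — existence and uniqueness alone** (the first clause of `existsUnique_smallSolution158W_valued`).
[cite: Balaban1985Variational, Prop. 6 p.295, (158) p.302] -/
theorem existsUnique_smallSolution158W [FiniteDimensional ℂ V] (src tgt : κ → ι)
    {w₀ w₃ : ι → ℝ} {w₁ : κ → ℝ} (hw₀ : ∀ i, 0 < w₀ i) (hw₁ : ∀ p, 0 < w₁ p) (hw₃ : ∀ i, 0 < w₃ i)
    (G : (ι → V) →ₗ[ℂ] (ι → V)) (W : (ι → V) → (ι → V)) {B₀ C₄ a₃ a ε₄ : ℝ} (hB₀ : 0 ≤ B₀) (hC₄ : 0 ≤ C₄)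
    (hG : ∀ (f : ι → V) (β : ℝ), (∀ i, w₃ i * ‖f i‖ ≤ β) →
      (∀ i, w₀ i * ‖G f i‖ ≤ B₀ * β) ∧ ∀ p, w₁ p * ‖G f (tgt p) - G f (src p)‖ ≤ B₀ * β)
    (hWq : ∀ (Y : ι → V) (r : ℝ), r < a₃ → (∀ i, w₀ i * ‖Y i‖ ≤ r) → (∀ p, w₁ p * ‖Y (tgt p) - Y (src p)‖ ≤ r) →
      ∀ i, w₃ i * ‖W Y i‖ ≤ C₄ * r ^ 2)
    (hWd : DifferentiableOn ℂ W {Y : ι → V | (∀ i, w₀ i * ‖Y i‖ < a₃) ∧ ∀ p, w₁ p * ‖Y (tgt p) - Y (src p)‖ < a₃})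
    (𝔄 : ι → V) (ha0 : 0 < a) (h𝔄 : ∀ i, w₀ i * ‖𝔄 i‖ < a) (h𝔄' : ∀ p, w₁ p * ‖𝔄 (tgt p) - 𝔄 (src p)‖ < a)
    (ha : a ≤ ε₄) (hε₄ : 0 ≤ ε₄) (h2 : 4 * ε₄ ≤ a₃) (h3 : 16 * B₀ * C₄ * ε₄ ≤ 1) :
    ∃! A₁ : ι → V, ((∀ i, w₀ i * ‖A₁ i‖ ≤ ε₄) ∧ ∀ p, w₁ p * ‖A₁ (tgt p) - A₁ (src p)‖ ≤ ε₄) ∧ A₁ + G (W (A₁ + 𝔄)) = 0 :=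
  (existsUnique_smallSolution158W_valued src tgt hw₀ hw₁ hw₃ G W hB₀ hC₄ hG hWq hWd 𝔄 ha0 h𝔄 h𝔄' ha hε₄ h2 h3).1

/-! ## §3 The (165) entry for an arbitrary letter, weighted; the linearised constraint -/

omit [Fintype ι] [Fintype κ] in
/-- **THE (165) ENTRY, WEIGHTED, FOR AN ARBITRARY LETTER**: if `N(−Gf) ≤ B_N·β` whenever `w₃·|f| ≤ β` pointwise, and `W` obeys (98) in the weighted sizes,
then every solution of `A₁ + G(W(A₁ + 𝔄)) = 0` with (115)-size(`A₁ + 𝔄`) `≤ ρ < a₃` has `N(A₁) ≤ B_N·C₄ρ²` — *«+ B₀C₄(36dL²B₁Mε₀)²»* on the cube sequence,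
any of the four sizes of (165). [cite: Balaban1985Variational, (165) p.304, (158) p.302] -/
theorem letter_solution158W_le (src tgt : κ → ι) {w₀ w₃ : ι → ℝ} {w₁ : κ → ℝ}
    (G : (ι → V) →ₗ[ℂ] (ι → V)) (W : (ι → V) → (ι → V)) {C₄ a₃ ρ : ℝ}
    (hWq : ∀ (Y : ι → V) (r : ℝ), r < a₃ → (∀ i, w₀ i * ‖Y i‖ ≤ r) → (∀ p, w₁ p * ‖Y (tgt p) - Y (src p)‖ ≤ r) →
      ∀ i, w₃ i * ‖W Y i‖ ≤ C₄ * r ^ 2)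
    {A₁ 𝔄 : ι → V} (hsol : A₁ + G (W (A₁ + 𝔄)) = 0) (hρ : ρ < a₃)
    (h1 : ∀ i, w₀ i * ‖(A₁ + 𝔄) i‖ ≤ ρ) (h2 : ∀ p, w₁ p * ‖(A₁ + 𝔄) (tgt p) - (A₁ + 𝔄) (src p)‖ ≤ ρ)
    (N : (ι → V) → ℝ) {B : ℝ} (hN : ∀ (f : ι → V) (β : ℝ), (∀ i, w₃ i * ‖f i‖ ≤ β) → N (-(G f)) ≤ B * β) :
    N A₁ ≤ B * (C₄ * ρ ^ 2) := by
  have hW := hWq (A₁ + 𝔄) ρ hρ h1 h2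
  rw [eq_neg_of_add_eq_zero_left hsol]
  exact hN _ _ hW

omit [Fintype ι] [Fintype κ] in
/-- **`Q ∘ G̃ = 0 ⇒ QA₁ = 0`** (*«Q𝔊 = 0»*, p. 294) for every additive `Q` on the fields of the cube (the multi-level constraints (156)–(157)).
[cite: Balaban1985Variational, (156)-(158) p.302, (108)-(111) p.294] -/
theorem solution158W_mem_ker {X : Type*} [AddCommGroup X] (Q : (ι → V) →+ X) (G : (ι → V) →ₗ[ℂ] (ι → V)) (W : (ι → V) → (ι → V))
    (hQ : ∀ f, Q (G f) = 0) {A₁ 𝔄 : ι → V} (hsol : A₁ + G (W (A₁ + 𝔄)) = 0) : Q A₁ = 0 := by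
  rw [eq_neg_of_add_eq_zero_left hsol, map_neg, hQ, neg_zero]

end Summit.QuantumFields.YangMills.Theorems.FlatSmallSolution158Levels

end
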